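import Summits.BirchSwinnertonDyer.Rank1Residual.Additive.X3BranchAlgebraicCountW
import HarnessLib

/-!
# X3 on the semistable-twist locus, cell (G-ord, `e = 2`): the algebraic count `hAlgWT` from the
# records `h23 ∧ h414 ∧ hGrK` with the residual LIFTING DISPLAYED and NO ramification hypothesis on the
# even line `Φ₀` — the form usable at `p = 3`, where the branch-parity line is UNRAMIFIED at `3`
# (cell `bsd-addord`, seat `bsd-addord-twist`, strategy = twist transport; sequel of
# `X3BranchAlgebraicCountW.lean`, same chain)

HONEST FRAMING (cell `bsd-addord`, `run/shared/lean/pub/bsd-addord/README.md` §4): the programme's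
target of record is the full Birch–Swinnerton-Dyer formula for every `E/ℚ` of analytic rank `≤ 1`;
this file concerns the X3 rows (`E[p]` reducible) of cell (G-ord, `e = 2`) of N10 at an odd `p`,
INCLUDING the non-degenerate `p = 3` rows. THEOREMS ONLY (no `def`, no named fact, no `sorry`); nothing
is booked by this file. PUBLISHED inputs are the displayed binders `h23`
(`datumSelmer_nonPrimitive_invariants`, GV 2000 Cor. (2.3) + Prop. (2.4) at the datum), `h414`
(`Greenberg1999.prop414_noFiniteSubmodule_of_not_dvd_torsionOrder`), `hGrK`
(`Greenberg1999.imKummer_ge_strictCondition_goodOrdinary`); the residual LIFTING (every class of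
`U ⊂ H¹(ℚ_Σ/ℚ_∞, W[p]/Φ₀)` lifts to `H¹(ℚ_Σ/ℚ_∞, W[p])` — GV p. 28 with p. 30's `H²(ℚ_Σ/ℚ_∞, Φ) = 0`,
"because `φ` is even") is a DISPLAYED hypothesis `hlift` in the Literature vocabulary of
`GreenbergVatsal2000/ResidualSelmerGroups.lean`: it is the tree's reading-fact
`residualEpsilon_surjOn_of_lineRamifiedEven` when `Φ₀` is ramified at `p` (the sibling file), and the
same printed argument (p. 30 uses only the evenness of `φ`) when `Φ₀` is unramified at `p` — to be
filed as a sibling reading-fact; until then `hlift` stays displayed on the `p = 3` rows.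

## What

The sibling `X3BranchAlgebraicCountW.lean` VERBATIM with two changes: (i) `¬ LineUnramifiedAt W p Φ₀`
is replaced by the non-triviality of the `Γ_ℚ`-action on `Φ₀` (`hnt`) — enough for `p ∤ #W(ℚ)_tors`
(`not_dvd_torsionOrder_of_line_of_nontrivial`: a `Γ_ℚ`-fixed point of `W[p]` off `Φ₀` is killed by
the odd quotient, on `Φ₀` it would make the action trivial; X2's `eq_zero_of_forall_smul_eq` pattern);
(ii) the lifting record `hLiftF` is replaced by the displayed `hlift`.

* §1 `eq_zero_of_forall_smul_eq_of_nontrivial`, `not_dvd_torsionOrder_of_line_of_nontrivial`.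
* §2 `natCard_line_mul_quotSelmer_eq_of_goodOrd_pStar_twist_of_lifting` — GV (16)+(11) for `W`.
* §3 `X3Branch.algebraicCountW_of_facts_of_lifting[_of_field]` — `hAlgWT` with `hlift` displayed.

References: [GreenbergVatsal2000] §2 (11), (16), pp. 26–30, Prop. (2.8), Remark (2.9), Cor. (2.3),
Prop. (2.4); [GreenbergLNM1716] Props. 2.2, 2.4, 4.14.
-/

set_option autoImplicit false

noncomputable section

open scoped Classical AddSubgroup

namespace Summit.BirchSwinnertonDyer.Rank1Residual.Additive

open NumberField IsDedekindDomain Field WeierstrassCurve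
  Literature.NumberTheory.GaloisRepresentations
  Literature.NumberTheory.EllipticCurves
  Literature.NumberTheory.EllipticCurves.GreenbergSelmer
  Literature.NumberTheory.EllipticCurves.GreenbergVatsal2000
  Literature.NumberTheory.EllipticCurves.EmertonPollackWeston2006
  Literature.NumberTheory.EllipticCurves.Rank1Residual
  Summit.BirchSwinnertonDyer.Rank1Residual.X2
  Summit.BirchSwinnertonDyer.Rank1Residual.X2.GreenbergVatsalTorsion
  Summit.BirchSwinnertonDyer.Rank1Residual.X2.GreenbergVatsalReductionDatum
  Summit.BirchSwinnertonDyer.Rank1Residual.X2.ResidualDevissageLine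
  Summit.BirchSwinnertonDyer.Rank1Residual.X1.MuLambda
  Summit.BirchSwinnertonDyer.Rank1Residual.GaloisImage.RamifiedOrdinaryLineTwist
  Summit.BirchSwinnertonDyer.Rank1Residual.AdditivePotMult
  Summit.BirchSwinnertonDyer.Rank1Residual.AdditivePotMult.RamifiedOrdinaryLinePotMult
  Summit.BirchSwinnertonDyer.Rank1Residual.Additive.TameDescent

/-! ### §1 No rational `p`-torsion from an even line with non-trivial `Γ_ℚ`-action -/

section NoTorsion

variable {W : WeierstrassCurve ℚ} [W.IsElliptic] {p : ℕ} [hp : Fact p.Prime]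
  {Φ₀ : AddSubgroup (geomTorsion W (p : ℤ))} (hΦ : IsRationalLine W p Φ₀)

include hΦ in
/-- **`W[p]^{Γ_ℚ} = 0`** when `W[p]` has a rational line `Φ₀` that is EVEN and carries a NON-TRIVIAL
`Γ_ℚ`-action, `p` odd: a fixed `P ≠ 0` has `2P = c•P + P ∈ Φ₀` (X2 `smul_add_self_mem_of_lineEven`),
so `P ∈ Φ₀` spans it and `Γ_ℚ` would fix `Φ₀` pointwise. (X2's `eq_zero_of_forall_smul_eq` with
"ramified" replaced by "non-trivial action".) [cite: GreenbergVatsal2000, §2 Prop. (2.8), p. 28] -/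
theorem eq_zero_of_forall_smul_eq_of_nontrivial (hp2 : p ≠ 2) (heven : LineEven W p Φ₀)
    (hnt : ∃ (σ : absoluteGaloisGroup ℚ) (P : W.geomTorsion (p : ℤ)), P ∈ Φ₀ ∧ σ • P ≠ P)
    (P : geomTorsion W (p : ℤ)) (hP : ∀ g : absoluteGaloisGroup ℚ, g • P = P) : P = 0 := by
  by_contra hP0
  have hpr : p.Prime := Fact.out
  obtain ⟨c, hc⟩ := exists_isComplexConjugation (Rat.castHom ℝ)
  have h2 : (2 : ℕ) • P ∈ Φ₀ := by
    rw [two_nsmul]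
    nth_rewrite 1 [← hP c]
    exact smul_add_self_mem_of_lineEven hΦ hp2 heven hc P
  have hPΦ : P ∈ Φ₀ := TateLineDecomposition.mem_of_two_nsmul_mem W p hp2 Φ₀ h2
  have hle : AddSubgroup.zmultiples P ≤ Φ₀ := AddSubgroup.zmultiples_le.mpr hPΦ
  have hcardP : Nat.card (AddSubgroup.zmultiples P) = p := by
    rw [Nat.card_zmultiples, addOrderOf_eq_prime (nsmul_eq_zero_of_mem_geomTorsion P) hP0]
  haveI : Finite Φ₀ := Nat.finite_of_card_ne_zero (by rw [hΦ.1]; exact hpr.ne_zero)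
  have heq : AddSubgroup.zmultiples P = Φ₀ :=
    AddSubgroup.eq_of_le_of_card_ge hle (by rw [hΦ.1, hcardP])
  obtain ⟨σ, Q, hQ, hne⟩ := hnt
  apply hne
  rw [← heq] at hQ
  obtain ⟨k, rfl⟩ := AddSubgroup.mem_zmultiples_iff.mp hQ
  change DistribSMul.toAddMonoidHom (geomTorsion W (p : ℤ)) σ (k • P) = _
  rw [map_zsmul, DistribSMul.toAddMonoidHom_apply, hP σ]

include hΦ in
/-- **`p ∤ #W(ℚ)_tors`** for an even rational line with non-trivial `Γ_ℚ`-action, `p` odd: a rational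
point of order `p` (Cauchy in `W(ℚ)_tors`) gives a non-zero `Γ_ℚ`-fixed point of `W[p]`
(`exists_geomTorsion_of_addOrderOf_eq`). [cite: GreenbergVatsal2000, §2 Prop. (2.8), p. 28] -/
theorem not_dvd_torsionOrder_of_line_of_nontrivial (hp2 : p ≠ 2) (heven : LineEven W p Φ₀)
    (hnt : ∃ (σ : absoluteGaloisGroup ℚ) (P : W.geomTorsion (p : ℤ)), P ∈ Φ₀ ∧ σ • P ≠ P) :
    ¬ p ∣ W.torsionOrder := by
  intro h
  obtain ⟨T, hT⟩ := exists_addOrderOf_eq_of_dvd_torsionOrder W p h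
  obtain ⟨Pb, -, hPb0, hfix⟩ := exists_geomTorsion_of_addOrderOf_eq W
    ((Rank1Residual.addOrderOf_point_eq_of_subsingleton W _ _ _).trans hT)
  exact hPb0 (eq_zero_of_forall_smul_eq_of_nontrivial hΦ hp2 heven hnt Pb hfix)

end NoTorsion

/-! ### §2 Greenberg–Vatsal's (16)+(11) for the ADDITIVE `W = C • V^{(p*)}`, lifting displayed -/

section Count

variable {p : ℕ} [hp : Fact p.Prime] {W : WeierstrassCurve ℚ} [W.IsElliptic] [W.IsGloballyMinimal]

/-- **GV (16)+(11) for `Sel_{p^∞}(W/ℚ_∞)` at the ADDITIVE prime, from PRINT.** `p` odd; `V` globally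
minimal GOOD ORDINARY at `p` with `C • V^{(p*)} = W`; `K` quadratic with `θ² = p*`, `θ ∉ ℚ`; `Σ₀ ∌ p`
finite with the bad places `≠ p` inside; `Φ₀ ≤ W[p]` a rational line, EVEN, non-trivial
`Γ_ℚ`-action, ramified `χ_K`-twist; `κ` cyclotomic with topological generator `γ`; `D` ANY `Λ`-dual datum of
`Sel_{p^∞}(W/ℚ_∞)` whose module is TORSION with `μ = 0`. THEN
`#H¹(ℚ_Σ/ℚ_∞, Φ₀) · #U(W[p]/Φ₀) = p^{λ(D.X) + Σ_{v∈Σ₀} δ_v(W)}` — GRANTED the published records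
`h23` (GV Cor. (2.3)/Prop. (2.4) at the datum), `h414` (Greenberg Prop. 4.14), `hGrK` (Greenberg
Props. 2.2/2.4); the residual lifting `hlift` (GV p. 28/30) is DISPLAYED and `Φ₀` carries a
non-trivial `Γ_ℚ`-action (`hnt`) instead of being ramified at `p`. Chain as in the sibling.
[cite: GreenbergVatsal2000, §2 pp. 26–30 (display (16), (11)), Prop. (2.8), Remark (2.9), Cor. (2.3), Prop. (2.4)]
[cite: GreenbergLNM1716, Props. 2.2, 2.4 (pp. 73–75), Prop. 4.14] -/
theorem natCard_line_mul_quotSelmer_eq_of_goodOrd_pStar_twist_of_lifting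
    (h23 : datumSelmer_nonPrimitive_invariants)
    (h414 : Greenberg1999.prop414_noFiniteSubmodule_of_not_dvd_torsionOrder)
    (hGrK : Greenberg1999.imKummer_ge_strictCondition_goodOrdinary)
    (hp2 : p ≠ 2) (V : WeierstrassCurve ℚ) [V.IsElliptic] [V.IsGloballyMinimal] (hV : GoodOrd V p)
    {C : VariableChange ℚ} (hC : C • V.quadraticTwist ((-1 : ℚ) ^ (p / 2) * p) = W)
    (K : Type) [Field K] [NumberField K] [(galRange (K := ℚ) K).Normal]
    (h2 : Module.finrank ℚ K = 2) {θ : K} (hθ : θ ∉ Set.range (algebraMap ℚ K))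
    (hc : θ ^ 2 = algebraMap ℚ K ((-1) ^ (p / 2) * p))
    (S₀ : Finset (HeightOneSpectrum (𝓞 ℚ))) (hS₀ : ∀ v ∈ S₀, ((p : ℕ) : 𝓞 ℚ) ∉ v.asIdeal)
    (hS : ∀ v : HeightOneSpectrum (𝓞 ℚ), v ∉ S₀ → ((p : ℕ) : 𝓞 ℚ) ∉ v.asIdeal →
      W.HasGoodReductionAt v)
    {Φ₀ : AddSubgroup (W.geomTorsion (p : ℤ))} (hΦ : IsRationalLine W p Φ₀)
    (heven : LineEven W p Φ₀)
    (hnt : ∃ (σ : absoluteGaloisGroup ℚ) (P : W.geomTorsion (p : ℤ)), P ∈ Φ₀ ∧ σ • P ≠ P)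
    (hram : ¬ ∀ w : HeightOneSpectrum (𝓞 ℚ), ((p : ℕ) : 𝓞 ℚ) ∈ w.asIdeal →
      ∀ 𝔓 ∈ w.primesAbove, ∀ σ ∈ 𝔓.inertia (absoluteGaloisGroup ℚ), ∀ P ∈ Φ₀,
        σ • P = (if σ ∈ galRange (K := ℚ) K then P else -P))
    (hlift : ∀ (κ : ZpExtension ℚ p), κ.IsCyclotomic →
      ∀ s ∈ residualQuotSelmer W p κ S₀ Φ₀ hΦ, ∃ x ∈ residualTorsionH1 W p κ S₀,
        residualEpsilon W p κ Φ₀ hΦ x = s)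
    {κ : ZpExtension ℚ p} {γ : absoluteGaloisGroup ℚ} (hκ : κ.IsCyclotomic) (hγ : κ.IsTopGenerator γ)
    (D : W.SelmerDualData κ γ) [Module.Finite (IwasawaAlgebra p) D.X] (hDt : D.IsTorsion)
    (hμ : D.mu = 0) :
    Nat.card (residualLineH1 W p κ S₀ Φ₀ hΦ) * Nat.card (residualQuotSelmer W p κ S₀ Φ₀ hΦ) =
      p ^ (lambdaInvariant p D.X + ∑ v ∈ S₀, delta W p v) := by
  have hS₀' : ∀ v ∈ (↑S₀ : Set (HeightOneSpectrum (𝓞 ℚ))), ((p : ℕ) : 𝓞 ℚ) ∉ v.asIdeal :=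
    fun v hv ↦ hS₀ v (Finset.mem_coe.mp hv)
  have hS' : ∀ v : HeightOneSpectrum (𝓞 ℚ), v ∉ (↑S₀ : Set (HeightOneSpectrum (𝓞 ℚ))) →
      ((p : ℕ) : 𝓞 ℚ) ∉ v.asIdeal → W.HasGoodReductionAt v :=
    fun v hv hpv ↦ hS v (fun h ↦ hv (Finset.mem_coe.2 h)) hpv
  -- the twisted Greenberg data: ramified ordinary lines whose `p`-torsion plus-part is `Φ₀`
  obtain ⟨Lf, hLf, hplus⟩ :=
    exists_data_isRamifiedOrdinaryLine_plus_eq_lineSub V K h2 hθ p hc hC hp2 hV hΦ hram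
  -- R-D identification at the ramified ordinary lines (mod `hGrK`)
  have hRD : ∀ (v : HeightOneSpectrum (𝓞 ℚ)) (hv : ((p : ℕ) : 𝓞 ℚ) ∈ v.asIdeal),
      (Lf v hv).greenbergKer κ.kerSubgroup = W.localKerOver p κ.kerSubgroup (v.adicCompletion ℚ) :=
    fun v hv ↦ ramifiedLineKummerEqAt_of_goodOrd_pStar_twist p hGrK hp2 V ⟨C, hC⟩ hV κ hκ v hv
      (Lf v hv) (hLf v hv)
  -- no rational `p`-torsion
  have htors : ¬ p ∣ W.torsionOrder := not_dvd_torsionOrder_of_line_of_nontrivial hΦ hp2 heven hnt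
  -- `Sel = S_A`, `Sel^{Σ₀} = S^{Σ₀}_A`
  have hSel := selmerInfty_eq_datumSelmerInfty W p κ hp2 hκ Lf hRD
  have hNP := nonPrimitiveSelmerInfty_eq_datumSelmerInfty W p κ
    (↑S₀ : Set (HeightOneSpectrum (𝓞 ℚ))) hp2 hκ Lf hRD hS₀'
  -- the record in classical currency on X2's non-primitive dual
  set DS := X2.NonPrimitiveSelmerDual.nonPrimitiveDualData W κ
    (↑S₀ : Set (HeightOneSpectrum (𝓞 ℚ))) hγ with hDS
  obtain ⟨hfg, ht, hμS, hlamS, hdiv⟩ :=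
    record_consequences_of_eq h23 hp2 hκ hγ Lf hLf htors S₀ hS₀ hSel hNP D hDt DS
  haveI := hfg
  have hμS' : muInvariant p DS.X = 0 := by rw [hμS]; exact hμ
  -- no finite submodule (Greenberg 4.14) ⟹ `#Sel^{Σ₀}[p] = p^{λ(X^{Σ₀})} = p^{λ(X) + Σδ}`
  have hnf := nonPrimitive_noFiniteSubmodule_of_prop414 h414 htors hκ hγ D hDt DS hdiv
  have hcount := natCard_torsionBy_nonPrimitiveSelmerInfty_eq_pow_lambdaInvariant κ
    (↑S₀ : Set (HeightOneSpectrum (𝓞 ℚ))) DS ht hμS' hnf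
  rw [hlamS, natCard_torsionBy_nonPrimitiveSelmerInfty_eq_of_greenbergKer_eq W p κ
    (↑S₀ : Set (HeightOneSpectrum (𝓞 ℚ))) hp2 hκ Lf hRD hS₀' hS'] at hcount
  -- GV Prop. (2.8) / Remark (2.9): `#S^{Σ₀}_{W[p]} = #(S^{Σ₀}_{W[p^∞]} ⊓ H¹[p]) · 1`
  haveI := finite_fixedPoints_of_not_dvd_torsionOrder W κ htors
  have h28 := GreenbergVatsalTorsionRamified.natCard_gvSelmer_torsion_curve_of_invariants_eq_bot_of_finite
    W p κ.kerSubgroup Lf (↑S₀ : Set (HeightOneSpectrum (𝓞 ℚ))) hS'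
    (fun v hv ↦ fun c hc' ↦ (hLf v hv).divisible hc')
    (RamifiedOrdinaryLineQuotientModelFree.data_gr_invariants_eq_zero_of_isRamifiedOrdinaryLine hp2 κ
      Lf hLf)
  rw [natCard_torsionBy_fixedPoints_eq_one W κ htors, mul_one] at h28
  -- display (16) at the twisted datum
  obtain ⟨c, hcc⟩ := exists_isComplexConjugation (Rat.castHom ℝ)
  have hdev := X3TwistedDatum.natCard_gvSelmer_torsion_eq_mul_of_plus_eq_line hΦ hp2 heven Lf hplus
    (↑S₀ : Set (HeightOneSpectrum (𝓞 ℚ))) hS' κ.kerSubgroup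
    (ResidualDevissageLine.mem_kerSubgroup_of_isComplexConjugation κ hcc) hcc
    (hlift κ hκ)
  -- assembly
  change Nat.card (GreenbergVatsal2000.unramifiedOutside κ.kerSubgroup (lineSub Φ₀ hΦ).Sub p
      (↑S₀ : Set (HeightOneSpectrum (𝓞 ℚ)))) *
    Nat.card (ResidualDevissageSelmer.quotSelmer κ.kerSubgroup (lineSub Φ₀ hΦ).Quot p
      (↑S₀ : Set (HeightOneSpectrum (𝓞 ℚ)))) = _
  rw [← hdev, h28]
  rw [gvSelmerInfty] at hcount
  exact hcount

end Count

/-! ### §3 The displayed count `hAlgWT`, lifting displayed -/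

section AlgW

variable {p : ℕ} [hp : Fact p.Prime] {W : WeierstrassCurve ℚ} [W.IsElliptic] [W.IsGloballyMinimal]

/-- **`hAlgW` (torsion-displayed form) FROM PRINT, for one quadratic `K`.** `p` odd; `V` good ordinary
at `p` with `C • V^{(p*)} = W`; `K ∋ θ`, `θ² = p*`, `θ ∉ ℚ`; `Σ₀`, `Φ₀` (rational line, ramified at
`p`, even, ramified `χ_K`-twist) as in §1. THEN for every cyclotomic `κ`, topological generator `γ`,
`Λ`-dual datum `D` of `Sel_{p^∞}(W/ℚ_∞)` with `D.X` TORSION, and generator `g` of `char_Λ D.X` with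
`μ(g) = 0`: `p^{λ(g) + Σ_{v∈Σ₀} δ_v(W)} = #H¹(ℚ_Σ/ℚ_∞, Φ₀)·#U(W[p]/Φ₀)` — GV (16)+(11) for the additive
`W`, with the residual LIFTING displayed (`hlift`, GV p. 28/30) and `Φ₀` of ANY ramification at
`p` (non-trivial `Γ_ℚ`-action `hnt` instead). Records: `h23`, `h414`, `hGrK`.
[cite: GreenbergVatsal2000, §2 pp. 26–30 (display (16), (11))] [cite: GreenbergLNM1716, Props. 2.2, 2.4, 4.14] -/
theorem X3Branch.algebraicCountW_of_facts_of_lifting_of_field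
    (h23 : datumSelmer_nonPrimitive_invariants)
    (h414 : Greenberg1999.prop414_noFiniteSubmodule_of_not_dvd_torsionOrder)
    (hGrK : Greenberg1999.imKummer_ge_strictCondition_goodOrdinary)
    (hp2 : p ≠ 2) (V : WeierstrassCurve ℚ) [V.IsElliptic] [V.IsGloballyMinimal] (hV : GoodOrd V p)
    {C : VariableChange ℚ} (hC : C • V.quadraticTwist ((-1 : ℚ) ^ (p / 2) * p) = W)
    (K : Type) [Field K] [NumberField K] [(galRange (K := ℚ) K).Normal]
    (h2 : Module.finrank ℚ K = 2) {θ : K} (hθ : θ ∉ Set.range (algebraMap ℚ K))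
    (hc : θ ^ 2 = algebraMap ℚ K ((-1) ^ (p / 2) * p))
    (S₀ : Finset (HeightOneSpectrum (𝓞 ℚ))) (hS₀ : ∀ v ∈ S₀, ((p : ℕ) : 𝓞 ℚ) ∉ v.asIdeal)
    (hS : ∀ v : HeightOneSpectrum (𝓞 ℚ), v ∉ S₀ → ((p : ℕ) : 𝓞 ℚ) ∉ v.asIdeal →
      W.HasGoodReductionAt v)
    (Φ₀ : AddSubgroup (W.geomTorsion (p : ℤ))) (hΦ : IsRationalLine W p Φ₀)
    (heven : LineEven W p Φ₀)
    (hnt : ∃ (σ : absoluteGaloisGroup ℚ) (P : W.geomTorsion (p : ℤ)), P ∈ Φ₀ ∧ σ • P ≠ P)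
    (hram : ¬ ∀ w : HeightOneSpectrum (𝓞 ℚ), ((p : ℕ) : 𝓞 ℚ) ∈ w.asIdeal →
      ∀ 𝔓 ∈ w.primesAbove, ∀ σ ∈ 𝔓.inertia (absoluteGaloisGroup ℚ), ∀ P ∈ Φ₀,
        σ • P = (if σ ∈ galRange (K := ℚ) K then P else -P))
    (hlift : ∀ (κ : ZpExtension ℚ p), κ.IsCyclotomic →
      ∀ s ∈ residualQuotSelmer W p κ S₀ Φ₀ hΦ, ∃ x ∈ residualTorsionH1 W p κ S₀,
        residualEpsilon W p κ Φ₀ hΦ x = s)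
    {κ : ZpExtension ℚ p} {γ : absoluteGaloisGroup ℚ} (D : W.SelmerDualData κ γ)
    (g : IwasawaAlgebra p) (hκ : κ.IsCyclotomic) (hγ : κ.IsTopGenerator γ) (hDt : D.IsTorsion)
    (hchar : D.charIdeal = Ideal.span {g}) (hμg : HasUnitContent g) :
    p ^ (lam g + ∑ v ∈ S₀, delta W p v) =
      Nat.card (residualLineH1 W p κ S₀ Φ₀ hΦ) * Nat.card (residualQuotSelmer W p κ S₀ Φ₀ hΦ) := by
  haveI : Module.Finite (IwasawaAlgebra p) D.X := D.module_finite_holds hγ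
  have hg0 : g ≠ 0 := X11a.ne_zero_of_hasUnitContent hμg
  have hμ : D.mu = 0 := (mu_eq_zero_iff_hasUnitContent D hDt hchar).mpr hμg
  have hlam : lam g = lambdaInvariant p D.X :=
    X1.ParitySqueeze.lam_generator_eq_lambdaInvariant D.X hDt hg0 hchar
  rw [hlam]
  exact (natCard_line_mul_quotSelmer_eq_of_goodOrd_pStar_twist_of_lifting h23 h414 hGrK hp2 V hV hC K
    h2 hθ hc S₀ hS₀ hS hΦ heven hnt hram hlift hκ hγ D hDt hμ).symm

/-- **`hAlgW` (torsion-displayed form) FROM PRINT — the `∀ K` reading of "`χ`-twist ramified" used by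
the end-state files.** As `X3Branch.algebraicCountW_of_facts_of_field`, with the ramified-twist
hypothesis stated for EVERY quadratic `K` with `θ² = p*` (the binder `hram` of
`X3Branch.charIdeal_eq_span_of_thm312_of_algebraicCountW`); instantiated at `ℚ(√p*) ⊂ ℚ(ζ_p)`.
[cite: GreenbergVatsal2000, §2 pp. 26–30 (display (16), (11))] [cite: GreenbergLNM1716, Props. 2.2, 2.4, 4.14] -/
theorem X3Branch.algebraicCountW_of_facts_of_lifting
    (h23 : datumSelmer_nonPrimitive_invariants)
    (h414 : Greenberg1999.prop414_noFiniteSubmodule_of_not_dvd_torsionOrder)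
    (hGrK : Greenberg1999.imKummer_ge_strictCondition_goodOrdinary)
    (hp2 : p ≠ 2) (V : WeierstrassCurve ℚ) [V.IsElliptic] [V.IsGloballyMinimal] (hV : GoodOrd V p)
    {C : VariableChange ℚ} (hC : C • V.quadraticTwist ((-1 : ℚ) ^ (p / 2) * p) = W)
    (S₀ : Finset (HeightOneSpectrum (𝓞 ℚ))) (hS₀ : ∀ v ∈ S₀, ((p : ℕ) : 𝓞 ℚ) ∉ v.asIdeal)
    (hS : ∀ v : HeightOneSpectrum (𝓞 ℚ), v ∉ S₀ → ((p : ℕ) : 𝓞 ℚ) ∉ v.asIdeal →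
      W.HasGoodReductionAt v)
    (Φ₀ : AddSubgroup (W.geomTorsion (p : ℤ))) (hΦ : IsRationalLine W p Φ₀)
    (heven : LineEven W p Φ₀)
    (hnt : ∃ (σ : absoluteGaloisGroup ℚ) (P : W.geomTorsion (p : ℤ)), P ∈ Φ₀ ∧ σ • P ≠ P)
    (hram : ∀ (K : Type) [Field K] [NumberField K] [(galRange (K := ℚ) K).Normal],
      Module.finrank ℚ K = 2 → (∃ θ : K, θ ^ 2 = algebraMap ℚ K ((-1) ^ (p / 2) * p)) →
      ¬ ∀ v : HeightOneSpectrum (𝓞 ℚ), ((p : ℕ) : 𝓞 ℚ) ∈ v.asIdeal →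
        ∀ 𝔓 ∈ v.primesAbove, ∀ σ ∈ 𝔓.inertia (absoluteGaloisGroup ℚ), ∀ P ∈ Φ₀,
          σ • P = (if σ ∈ galRange (K := ℚ) K then P else -P))
    (hlift : ∀ (κ : ZpExtension ℚ p), κ.IsCyclotomic →
      ∀ s ∈ residualQuotSelmer W p κ S₀ Φ₀ hΦ, ∃ x ∈ residualTorsionH1 W p κ S₀,
        residualEpsilon W p κ Φ₀ hΦ x = s)
    {κ : ZpExtension ℚ p} {γ : absoluteGaloisGroup ℚ} (D : W.SelmerDualData κ γ)
    (g : IwasawaAlgebra p) (hκ : κ.IsCyclotomic) (hγ : κ.IsTopGenerator γ) (hDt : D.IsTorsion)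
    (hchar : D.charIdeal = Ideal.span {g}) (hμg : HasUnitContent g) :
    p ^ (lam g + ∑ v ∈ S₀, delta W p v) =
      Nat.card (residualLineH1 W p κ S₀ Φ₀ hΦ) * Nat.card (residualQuotSelmer W p κ S₀ Φ₀ hΦ) := by
  obtain ⟨K, _, _, h2, θ, hθ, hc⟩ := exists_numberField_sq_eq_pStar (p := p) hp2
  haveI : IsGalois ℚ K := isGalois_of_finrank_eq_two K h2
  haveI : (galRange (K := ℚ) K).Normal := normal_galRange K h2 (sigmaQ_ne_one K h2 hθ hc)
  exact X3Branch.algebraicCountW_of_facts_of_lifting_of_field h23 h414 hGrK hp2 V hV hC K h2 hθ hc S₀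
    hS₀ hS Φ₀ hΦ heven hnt (hram K h2 ⟨θ, hc⟩) hlift D g hκ hγ hDt hchar hμg

end AlgW

end Summit.BirchSwinnertonDyer.Rank1Residual.Additive

end
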